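import Summits.HubbardSuperconductivity.HubbardSuperconductivity.Theorems.BirGroundStateAverageLRO.Negative.PairingCost
import Literature.MathematicalPhysics.QuantumLattice.FreeFermiGasPairingCostLog
import Literature.MathematicalPhysics.QuantumLattice.HubbardPairDensityCouplingCeiling

/-!
# Crux `BirGroundStateAverageLRO` (item `stmt-HubbardSuperconductivity-2079`): the window floor at the BCS rate `c / log(1/c)`

The crux (`Theses.BalabanIR.BirGroundStateAverageLRO`, route BalabanIR, target / rank 0) asks, on a
window of couplings `0 < U₁ < U < U₂`, eventually in even `L`, the ground-state-AVERAGE `d`-wave pair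
LRO `c·L⁴·Re tr P ≤ Re tr (P Δ_d† Δ_d)` for the projection `P` onto the ground eigenspace of
`hubbardTorus 2 L 1 U` in the sector `(2⌊(1-δ)L²/2⌋, S^z = 0)`, at a doping `δ ∈ (0, 1/2)`.

The crux's own data — doping `δ > 0` (Fermi level strictly below the van Hove level) and EVEN `L`
(exact particle–hole symmetry of the band) — are exactly what the logarithmic pairing-cost rate of
`Literature/…/FreeFermiGasPairingCostLog.lean` needs: with `d₀ = (δ/4)²` the free Fermi level of
`⌊(1-δ)L²/2⌋` levels per spin lies in `[-4 + d₀, -d₀]` for `L ≥ ⌈160/δ⌉ + 17`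
(`fermiLevel_conditions`, from `TorusBandParticleHole.lean`). Hence (negative side only; nothing
asserts a Theses decl; every mutated statement is spelled out):

* `avgBound_coupling_floor_log` — POINTWISE: the crux's inequality at ONE datum `(δ, U, c, L)` with
  `δ ∈ (0,1/2)`, `U ≥ 0`, `c > 0`, even `L ≥ ⌈12800/c⌉ + ⌈160/δ⌉ + 17` forces
  `δ·c / (16384 · log(4 + 32/√c)) ≤ U`: the ground-state-average `d`-wave pair density of the doped
  repulsive Hubbard torus is `O_δ(U log(1/U))` — the Bardeen–Cooper–Schrieffer rate of the pairing
  cost against the first-order kinetic budget `U·L²` (was `O(U^{2/3})`, `Negative/PairingCostOptimal`).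
* `birGroundStateAverageLRO_window_floor_log` / `…_witness_floor_log` — every witness
  `(δ, U₁, U₂, c)` of the crux (indeed of its weakening with `0 ≤ U₁`) satisfies
  `δ·c / (16384 · log(4 + 32/√c)) ≤ U₁`.
* `pairingCostWitnessFloorLog` — the one-line registered form (stub of crux `stmt-…-2079`).

Regime map for the planners / the standing disprover: an engine for the crux must output
`c(U₁) ≲ δ⁻¹ U₁ log(1/U₁)` (and `≤ 32`); the expected truth is `e^{-O(1/U)}`-small
(`PerturbativeInvisibilityOfPairing`). The pairing cost is now charged at the BCS rate, so a further
sharpening of the a-priori ceiling needs a SECOND-order kinetic budget (correlation-energy bounds of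
Hartree–Fock accuracy type), not a better pairing inequality.

Sources: Bardeen–Cooper–Schrieffer, Phys. Rev. 108 (1957) 1175, §II–III; C. N. Yang, Rev. Mod.
Phys. 34 (1962) 694, §3; E. H. Lieb, Phys. Rev. Lett. 62 (1989) 1201 (particle–hole symmetry);
Tasaki (2020) §2.2 (variational principle). Folklore finite-dimensional statements; no named facts,
no definitions.
-/

noncomputable section

namespace Summit.HubbardSuperconductivity.HubbardSuperconductivity.Theorems.BirGroundStateAverageLRO.Negative

open Matrix Finset Filter
open Literature.Probability.LatticeModels Literature.MathematicalPhysics.QuantumLattice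
open Summit.HubbardSuperconductivity.HubbardSuperconductivity.Theorems
open scoped ComplexOrder

/-- **Fermi-level bookkeeping at doping `δ`, even `L`.** For `δ ∈ (0,1/2)`, even
`L ≥ ⌈160/δ⌉ + 17`, `d₀ = (δ/4)²` and `n = ⌊(1-δ)L²/2⌋`: (i) `n ≤ #{k : ε_L(k) ≤ -d₀}` (particle–hole
symmetry leaves at least `(L² - (δ/4)L² - 2L)/2 ≥ n` levels below `-d₀`), (ii)
`#{k : ε_L(k) < -4 + d₀} < n` (at most `(δ/4)L² + 2L` levels near the band bottom), (iii)
`√d₀·L ≥ 40`. [folklore] -/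
theorem fermiLevel_conditions {δ : ℝ} (hδ : δ ∈ Set.Ioo (0:ℝ) (1/2)) (L : ℕ) [NeZero L]
    (hL : ⌈160 / δ⌉₊ + 17 ≤ L) (hev : Even L) :
    ⌊(1 - δ) * (L : ℝ) ^ 2 / 2⌋₊ ≤
        (Finset.univ.filter fun k : TorusSite 2 L => torusBand L k ≤ -((δ / 4) ^ 2)).card ∧
      (Finset.univ.filter fun k : TorusSite 2 L => torusBand L k < (-4 : ℝ) + (δ / 4) ^ 2).card <
        ⌊(1 - δ) * (L : ℝ) ^ 2 / 2⌋₊ ∧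
      40 ≤ Real.sqrt ((δ / 4) ^ 2) * L := by
  obtain ⟨hδ0, hδ1⟩ := hδ
  have hsq : Real.sqrt ((δ / 4) ^ 2) = δ / 4 := Real.sqrt_sq (by positivity)
  have hL17 : (17 : ℝ) ≤ L := by exact_mod_cast (show 17 ≤ L by omega)
  have hLδ : 160 / δ ≤ (L : ℝ) := by
    have hceil : 160 / δ ≤ (⌈160 / δ⌉₊ : ℝ) := Nat.le_ceil _
    have : (⌈160 / δ⌉₊ : ℝ) + 17 ≤ L := by exact_mod_cast hL
    linarith
  have hδL : 160 ≤ δ * L := by rwa [div_le_iff₀' hδ0] at hLδ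
  have hL0 : (0 : ℝ) ≤ L := Nat.cast_nonneg _
  set y : ℝ := (1 - δ) * (L : ℝ) ^ 2 / 2 with hy
  have hy0 : 0 ≤ y := by rw [hy]; nlinarith [sq_nonneg (L : ℝ)]
  have hfloor_le : (⌊y⌋₊ : ℝ) ≤ y := Nat.floor_le hy0
  have hlt_floor : y - 1 < (⌊y⌋₊ : ℝ) := Nat.sub_one_lt_floor y
  refine ⟨?_, ?_, ?_⟩
  · -- (i)
    have h := sub_le_two_mul_card_filter_torusBand_le_neg (L := L) hev
      (t := (δ / 4) ^ 2) (by positivity)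
    rw [hsq] at h
    have hreal : (⌊y⌋₊ : ℝ) ≤
        ((Finset.univ.filter fun k : TorusSite 2 L => torusBand L k ≤ -((δ / 4) ^ 2)).card : ℝ) := by
      have : 2 * y ≤ (L : ℝ) ^ 2 - δ / 4 * (L : ℝ) ^ 2 - 2 * L := by
        rw [hy]
        nlinarith [mul_le_mul_of_nonneg_right hδL hL0]
      linarith
    exact_mod_cast hreal
  · -- (ii)
    have h := card_filter_torusBand_lt_neg_four_add_le (L := L) ((δ / 4) ^ 2)
    rw [hsq] at h
    have hreal : ((Finset.univ.filter fun k : TorusSite 2 L =>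
        torusBand L k < (-4 : ℝ) + (δ / 4) ^ 2).card : ℝ) < (⌊y⌋₊ : ℝ) := by
      have hcoef : (1 : ℝ) / 8 ≤ 1 / 2 - 3 * δ / 4 := by linarith
      have : δ / 4 * (L : ℝ) ^ 2 + 2 * L ≤ y - 1 := by
        rw [hy]
        nlinarith [mul_le_mul_of_nonneg_right hcoef (sq_nonneg (L : ℝ))]
      linarith
    exact_mod_cast hreal
  · -- (iii)
    rw [hsq]
    linarith

/-- **Pointwise coupling floor at the BCS rate.** If the crux's ground-state-average bound
`c·L⁴·Re tr P ≤ Re tr (P Δ_d†Δ_d)` holds at ONE datum `(δ, U, c, L)` with `δ ∈ (0,1/2)`, `U ≥ 0`,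
`c > 0` and EVEN `L ≥ ⌈12800/c⌉ + ⌈160/δ⌉ + 17`, then `δ·c / (16384 · log(4 + 32/√c)) ≤ U`: a sector
ground state carrying the bound (`exists_groundState_le_of_trace_bound`) has free-energy excess
`≤ U·L²` (`re_free_energy_groundState_le`) and `≥ (δ/4)·c/(4096·log(4 + 32/√c))·L²`
(`freeDWavePairing_costs_energy_log_explicit` with `d₀ = (δ/4)²`, `fermiLevel_conditions`).
[folklore] -/
theorem avgBound_coupling_floor_log (L : ℕ) [NeZero L] {δ U c : ℝ} (hδ : δ ∈ Set.Ioo (0:ℝ) (1/2))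
    (hU : 0 ≤ U) (hc : 0 < c) (hL : ⌈12800 / c⌉₊ + ⌈160 / δ⌉₊ + 17 ≤ L) (hev : Even L)
    (h : let N : ℕ := 2 * ⌊(1 - δ) * (L : ℝ) ^ 2 / 2⌋₊
      let H := hubbardTorus 2 L 1 U
      let S := szSector (Λ := FermionTorus 2 L) N 0
      let E₀ := S ⊓ Module.End.eigenspace (Matrix.toLin' H) ((H.minEnergyOn S : ℝ) : ℂ)
      let P := projMatrix (E₀.map (Fock.toEuclidean (ι := Orb (FermionTorus 2 L)) :
        Fock (Orb (FermionTorus 2 L)) →ₗ[ℂ] EuclideanSpace ℂ (Finset (Orb (FermionTorus 2 L)))))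
      c * (L : ℝ) ^ 4 * P.trace.re ≤
        (P * ((pairField dWaveFormFactor L)ᴴ * pairField dWaveFormFactor L)).trace.re) :
    δ * c / (16384 * Real.log (4 + 32 / Real.sqrt c)) ≤ U := by
  have hδ' : (-1 : ℝ) ≤ δ := by linarith [hδ.1]
  obtain ⟨ψ, hgs, h1, hle⟩ := exists_groundState_le_of_trace_bound L 1 U δ c hδ' h
  have hn := NoGo.floor_pairNumber_le δ hδ' L
  obtain ⟨hC1, hC2, hLd⟩ := fermiLevel_conditions hδ L (by omega) hev
  have hL3 : 3 ≤ L := by omega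
  have hLc : 12800 ≤ c * (L : ℝ) ^ 2 := by
    have hceil : 12800 / c ≤ (⌈12800 / c⌉₊ : ℝ) := Nat.le_ceil _
    have hL' : (⌈12800 / c⌉₊ : ℝ) ≤ (L : ℝ) := by exact_mod_cast (show ⌈12800 / c⌉₊ ≤ L by omega)
    have hle' : 12800 / c ≤ (L : ℝ) := hceil.trans hL'
    rw [div_le_iff₀' hc] at hle'
    have hL1 : (1 : ℝ) ≤ L := by exact_mod_cast (show 1 ≤ L by omega)
    nlinarith
  have hd : (0 : ℝ) < (δ / 4) ^ 2 := by have := hδ.1; positivity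
  have hcost := freeDWavePairing_costs_energy_log_explicit hc hd hL3 hLc hLd hgs.1 h1 hC1 hC2 hle
  have hfree := re_free_energy_groundState_le L 1 U hU hn hgs h1
  have hsq : Real.sqrt ((δ / 4) ^ 2) = δ / 4 := Real.sqrt_sq (by linarith [hδ.1])
  rw [hsq] at hcost
  have hL2 : (0 : ℝ) < (L : ℝ) ^ 2 := by
    have : (0 : ℝ) < (L : ℝ) := by exact_mod_cast Nat.pos_of_ne_zero (NeZero.ne L)
    positivity
  have hmul : δ * c / (16384 * Real.log (4 + 32 / Real.sqrt c)) * (L : ℝ) ^ 2 ≤ U * (L : ℝ) ^ 2 := by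
    have e : δ / 4 * c / (4096 * Real.log (4 + 32 / Real.sqrt c)) =
        δ * c / (16384 * Real.log (4 + 32 / Real.sqrt c)) := by
      rw [div_mul_eq_mul_div, div_div]
      ring
    rw [← e]
    linarith
  exact le_of_mul_le_mul_right hmul hL2

/-- **Window floor for `BirGroundStateAverageLRO` at the BCS rate.** If the crux's average bound
with constant `c > 0` holds eventually in even `L` at every coupling of an interval `(U₁, U₂)`,
`0 ≤ U₁ < U₂` (`δ ∈ (0,1/2)`), then `δ·c / (16384 · log(4 + 32/√c)) ≤ U₁` (pick a coupling of the
window below the rate and a large even side; the pointwise floor contradicts it). [folklore] -/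
theorem birGroundStateAverageLRO_window_floor_log {δ U₁ U₂ c : ℝ}
    (hδ : δ ∈ Set.Ioo (0:ℝ) (1/2)) (hU₁ : 0 ≤ U₁) (hU : U₁ < U₂) (hc : 0 < c)
    (h : ∀ U ∈ Set.Ioo U₁ U₂, ∃ L₀ : ℕ, ∀ (L : ℕ) [NeZero L], L₀ ≤ L → Even L →
      let N : ℕ := 2 * ⌊(1 - δ) * (L : ℝ) ^ 2 / 2⌋₊
      let H := hubbardTorus 2 L 1 U
      let S := szSector (Λ := FermionTorus 2 L) N 0
      let E₀ := S ⊓ Module.End.eigenspace (Matrix.toLin' H) ((H.minEnergyOn S : ℝ) : ℂ)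
      let P := projMatrix (E₀.map (Fock.toEuclidean (ι := Orb (FermionTorus 2 L)) :
        Fock (Orb (FermionTorus 2 L)) →ₗ[ℂ] EuclideanSpace ℂ (Finset (Orb (FermionTorus 2 L)))))
      c * (L : ℝ) ^ 4 * P.trace.re ≤
        (P * ((pairField dWaveFormFactor L)ᴴ * pairField dWaveFormFactor L)).trace.re) :
    δ * c / (16384 * Real.log (4 + 32 / Real.sqrt c)) ≤ U₁ := by
  by_contra hlt
  push Not at hlt
  set η : ℝ := δ * c / (16384 * Real.log (4 + 32 / Real.sqrt c)) with hη
  set U := min ((U₁ + η) / 2) ((U₁ + U₂) / 2) with hUdef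
  have hUmem : U ∈ Set.Ioo U₁ U₂ := by
    constructor
    · simp only [hUdef, lt_min_iff]; constructor <;> linarith
    · exact (min_le_right _ _).trans_lt (by linarith)
  have hUη : U < η := (min_le_left _ _).trans_lt (by linarith)
  have hU0 : 0 ≤ U := le_trans hU₁ hUmem.1.le
  obtain ⟨L₀, hL₀⟩ := h U hUmem
  set m := max L₀ (⌈12800 / c⌉₊ + ⌈160 / δ⌉₊ + 17) + 1 with hm
  haveI : NeZero (2 * m) := ⟨by omega⟩
  have hbound := hL₀ (2 * m) (by omega) (even_two_mul m)
  have hfl := avgBound_coupling_floor_log (2 * m) hδ hU0 hc (by omega) (even_two_mul m) hbound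
  rw [← hη] at hfl
  linarith

/-- **Corollary for the crux itself, BCS rate.** Any witness `(δ, U₁, U₂, c)` of
`BirGroundStateAverageLRO` (with its `0 < U₁`) has `δ·c / (16384 · log(4 + 32/√c)) ≤ U₁`: the
admissible LRO constant is `O_δ(U₁ log(1/U₁))` in the lower edge of its window. [folklore] -/
theorem birGroundStateAverageLRO_witness_floor_log {δ U₁ U₂ c : ℝ}
    (hδ : δ ∈ Set.Ioo (0:ℝ) (1/2)) (hU₁ : 0 < U₁) (hU : U₁ < U₂) (hc : 0 < c)
    (h : ∀ U ∈ Set.Ioo U₁ U₂, ∃ L₀ : ℕ, ∀ (L : ℕ) [NeZero L], L₀ ≤ L → Even L →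
      let N : ℕ := 2 * ⌊(1 - δ) * (L : ℝ) ^ 2 / 2⌋₊
      let H := hubbardTorus 2 L 1 U
      let S := szSector (Λ := FermionTorus 2 L) N 0
      let E₀ := S ⊓ Module.End.eigenspace (Matrix.toLin' H) ((H.minEnergyOn S : ℝ) : ℂ)
      let P := projMatrix (E₀.map (Fock.toEuclidean (ι := Orb (FermionTorus 2 L)) :
        Fock (Orb (FermionTorus 2 L)) →ₗ[ℂ] EuclideanSpace ℂ (Finset (Orb (FermionTorus 2 L)))))
      c * (L : ℝ) ^ 4 * P.trace.re ≤
        (P * ((pairField dWaveFormFactor L)ᴴ * pairField dWaveFormFactor L)).trace.re) :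
    δ * c / (16384 * Real.log (4 + 32 / Real.sqrt c)) ≤ U₁ :=
  birGroundStateAverageLRO_window_floor_log hδ hU₁.le hU hc h

/-- **Registered stub `pairingCostWitnessFloorLog` (crux `stmt-HubbardSuperconductivity-2079`).**
Every witness `(δ, U₁, U₂, c)` of the crux satisfies the UNCONDITIONAL coupling floor
`δ·c / (16384 · log(4 + 32/√c)) ≤ U₁` (`birGroundStateAverageLRO_witness_floor_log`, one-line
registered form). [folklore] -/
theorem pairingCostWitnessFloorLog : ∀ (δ U₁ U₂ c : ℝ), δ ∈ Set.Ioo (0:ℝ) (1/2) → 0 < U₁ → U₁ < U₂ → 0 < c → (∀ U ∈ Set.Ioo U₁ U₂, ∃ L₀ : ℕ, ∀ (L : ℕ) [NeZero L], L₀ ≤ L → Even L → let N : ℕ := 2 * ⌊(1 - δ) * (L : ℝ) ^ 2 / 2⌋₊; let H := Literature.MathematicalPhysics.QuantumLattice.hubbardTorus 2 L 1 U; let S := Literature.MathematicalPhysics.QuantumLattice.szSector (Λ := Literature.MathematicalPhysics.QuantumLattice.FermionTorus 2 L) N 0; let E₀ := S ⊓ Module.End.eigenspace (Matrix.toLin'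 H) ((H.minEnergyOn S : ℝ) : ℂ); let P := Literature.MathematicalPhysics.QuantumLattice.projMatrix (E₀.map (Literature.MathematicalPhysics.QuantumLattice.Fock.toEuclidean (ι := Literature.MathematicalPhysics.QuantumLattice.Orb (Literature.MathematicalPhysics.QuantumLattice.FermionTorus 2 L)) : Literature.MathematicalPhysics.QuantumLattice.Fock (Literature.MathematicalPhysics.QuantumLattice.Orb (Literature.MathematicalPhysics.QuantumLattice.FermionTorus 2 L)) →ₗ[ℂ] EuclideanSpace ℂ (Finset (Literature.MathematicalPhysics.QuantumLattice.Orb (Literature.MathematicalPhysics.QuantumLattice.FermionTorus 2 L))))); c * (L : ℝ) ^ 4 * P.trace.re ≤ (P * (Matrix.conjTranspose (Literature.MathematicalPhysics.QuantumLattice.pairField Literature.MathematicalPhysics.QuantumLattice.dWaveFormFactor L) * Literature.MathematicalPhysics.QuantumLattice.pairField Literature.MathematicalPhysics.QuantumLattice.dWaveFormFactor L)).trace.re) → δ * c / (16384 * Real.log (4 + 32 / Real.sqrt c)) ≤ U₁ :=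
  fun _ _ _ _ hδ hU₁ hU hc h => birGroundStateAverageLRO_witness_floor_log hδ hU₁ hU hc h


/-! ### Appended 2026-08-16 (prover seat 2, s17): the witness ceiling in CLOSED form

`birGroundStateAverageLRO_witness_floor_log` bounds a witness `(δ, U₁, U₂, c)` of the crux implicitly
(`δ·c/(16384·log(4 + 32/√c)) ≤ U₁`, `c` on both sides). The elementary inversion
`le_mul_log_of_le_mul_log_sqrt_self'` of `Literature/…/HubbardPairDensityCouplingCeiling.lean` turns it into the
closed form `c ≤ (16384/δ)·U₁·log(4 + 32/√U₁)` — the regime map "admissible LRO constant versus lower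
window edge" with nothing implicit left. -/

/-- **Closed form of the witness ceiling at the BCS rate.** Every witness `(δ, U₁, U₂, c)` of
`BirGroundStateAverageLRO` has `c ≤ (16384/δ) · U₁ · log(4 + 32/√U₁)`: the admissible LRO constant
is `O_δ(U₁ log(1/U₁))` in the lower edge of its window, with no `c` on the right-hand side
(inversion of `birGroundStateAverageLRO_witness_floor_log`, using `16384/δ ≥ 1`). [folklore] -/
theorem birGroundStateAverageLRO_witness_ceiling_log {δ U₁ U₂ c : ℝ}
    (hδ : δ ∈ Set.Ioo (0:ℝ) (1/2)) (hU₁ : 0 < U₁) (hU : U₁ < U₂) (hc : 0 < c)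
    (h : ∀ U ∈ Set.Ioo U₁ U₂, ∃ L₀ : ℕ, ∀ (L : ℕ) [NeZero L], L₀ ≤ L → Even L →
      let N : ℕ := 2 * ⌊(1 - δ) * (L : ℝ) ^ 2 / 2⌋₊
      let H := hubbardTorus 2 L 1 U
      let S := szSector (Λ := FermionTorus 2 L) N 0
      let E₀ := S ⊓ Module.End.eigenspace (Matrix.toLin' H) ((H.minEnergyOn S : ℝ) : ℂ)
      let P := projMatrix (E₀.map (Fock.toEuclidean (ι := Orb (FermionTorus 2 L)) :
        Fock (Orb (FermionTorus 2 L)) →ₗ[ℂ] EuclideanSpace ℂ (Finset (Orb (FermionTorus 2 L)))))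
      c * (L : ℝ) ^ 4 * P.trace.re ≤
        (P * ((pairField dWaveFormFactor L)ᴴ * pairField dWaveFormFactor L)).trace.re) :
    c ≤ 16384 / δ * U₁ * Real.log (4 + 32 / Real.sqrt U₁) := by
  have hfl := birGroundStateAverageLRO_witness_floor_log hδ hU₁ hU hc h
  have hlog : 0 < Real.log (4 + 32 / Real.sqrt c) := by
    have : 0 < 32 / Real.sqrt c := by
      have := Real.sqrt_pos.2 hc
      positivity
    exact Real.log_pos (by linarith)
  have himp : c ≤ 16384 / δ * U₁ * Real.log (4 + 32 / Real.sqrt c) := by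
    rw [div_le_iff₀ (by positivity)] at hfl
    have e : 16384 / δ * U₁ * Real.log (4 + 32 / Real.sqrt c) =
        U₁ * (16384 * Real.log (4 + 32 / Real.sqrt c)) / δ := by ring
    rw [e, le_div_iff₀ hδ.1]
    linarith
  have hA : (1 : ℝ) ≤ 16384 / δ := by
    rw [le_div_iff₀ hδ.1]
    linarith [hδ.2]
  exact le_mul_log_of_le_mul_log_sqrt_self' hc hA hU₁ himp

/-- **The ceiling read as a regime map.** If `(16384/δ)·U₁·log(4 + 32/√U₁) < c` (with
`δ ∈ (0,1/2)`, `0 < U₁ < U₂`, `0 < c`) then `(δ, U₁, U₂, c)` is NOT a witness of the crux: on a window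
with lower edge `U₁` the crux can hold only with an LRO constant below the closed-form ceiling.
[folklore] -/
theorem not_avgBound_window_of_ceiling_lt {δ U₁ U₂ c : ℝ}
    (hδ : δ ∈ Set.Ioo (0:ℝ) (1/2)) (hU₁ : 0 < U₁) (hU : U₁ < U₂) (hc : 0 < c)
    (hlt : 16384 / δ * U₁ * Real.log (4 + 32 / Real.sqrt U₁) < c) :
    ¬ (∀ U ∈ Set.Ioo U₁ U₂, ∃ L₀ : ℕ, ∀ (L : ℕ) [NeZero L], L₀ ≤ L → Even L →
      let N : ℕ := 2 * ⌊(1 - δ) * (L : ℝ) ^ 2 / 2⌋₊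
      let H := hubbardTorus 2 L 1 U
      let S := szSector (Λ := FermionTorus 2 L) N 0
      let E₀ := S ⊓ Module.End.eigenspace (Matrix.toLin' H) ((H.minEnergyOn S : ℝ) : ℂ)
      let P := projMatrix (E₀.map (Fock.toEuclidean (ι := Orb (FermionTorus 2 L)) :
        Fock (Orb (FermionTorus 2 L)) →ₗ[ℂ] EuclideanSpace ℂ (Finset (Orb (FermionTorus 2 L)))))
      c * (L : ℝ) ^ 4 * P.trace.re ≤
        (P * ((pairField dWaveFormFactor L)ᴴ * pairField dWaveFormFactor L)).trace.re) := by
  intro h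
  have := birGroundStateAverageLRO_witness_ceiling_log hδ hU₁ hU hc h
  linarith

end Summit.HubbardSuperconductivity.HubbardSuperconductivity.Theorems.BirGroundStateAverageLRO.Negative
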